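import Mathlib
import Summits.NavierStokesRegularity.NavierStokesRegularity.Theses.FrozenSignCascade
import Summits.NavierStokesRegularity.NavierStokesRegularity.Theorems.FrozenSignCascadeEnvelopeBoundKato
import Summits.NavierStokesRegularity.NavierStokesRegularity.Theorems.FrozenSignCascadeBoundedEnvelopeContinuationAxisymmetric
import Summits.NavierStokesRegularity.NavierStokesRegularity.Theorems.CertifiedBlowupCertifiedBlowupAxisymBlowupSwirlEssential
import HarnessLib

/-!
# Route FrozenSignCascade · crux `EnvelopeBound` (stmt-NavierStokesRegularity-1549): the axisymmetric sector

Helper file for the crux item stmt-NavierStokesRegularity-1549 (`EnvelopeBound`, leaf (A) of route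
`FrozenSignCascade`), line `registered`, lead c8; landed `--supports` that item. It settles the crux
on the AXISYMMETRIC class of Clay data, datum by datum, with what the tree already proves:

1. `envelope_of_global_classical` — per datum: a Clay datum that admits a global classical
   bounded-energy solution satisfies the conclusion of the crux at every horizon `T₀`
   (`katoMaximalTime_eq_top_of_global_classical`, route CertifiedBlowup, and
   `Kato.envelope_of_lt_katoMaximalTime`, lead c5). `envelope_of_clay` is the same in the summit's
   (Fefferman's) vocabulary.
2. `envelope_of_hasNoSwirl` — UNCONDITIONAL: the conclusion of the crux holds for every
   axisymmetric swirl-free Clay datum (ns.S24, Ladyzhenskaya / Ukhovskii–Yudovich 1968, discharged in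
   the tree as `axisymmetric_no_swirl_global_regularity_holds`; Kato form
   `katoMaximalTime_eq_top_of_hasNoSwirl`). This is the first LARGE-data sector of (A) in the tree.
3. `envelopeBound_axisymmetric_iff_axisymmetricSwirlRegularity` — (A) restricted to axisymmetric
   Clay data is EQUIVALENT to the axisymmetric-with-swirl global regularity conjecture ns.S25
   (`Literature.Analysis.FluidPDE.AxisymmetricSwirlRegularity`): `←` by 1, `→` by the B-lead's
   unconditional axisymmetric case of crux (B) (`BoundedEnvelope.boundedEnvelopeContinuation_axisymmetric`,
   p168184: Seregin–Šverák 2009 / KNSS 2009 exclude axisymmetric Type I). Corollaries: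
   `axisymmetricSwirlRegularity_of_envelopeBound` ((A) ⇒ ns.S25),
   `not_certifiedBlowupAxisymBlowup_of_envelopeBound` ((A) refutes the crux
   `CertifiedBlowupAxisymBlowup` of route CertifiedBlowup, stmt-NavierStokesRegularity-0727) and
   `not_envelopeBound_of_certifiedBlowupAxisymBlowup` (a witness of stmt-0727 refutes (A)).

Nothing here credits the open stub `stub_farFromLeray` (≡ the crux, p160448): on axisymmetric data
WITH swirl the crux is exactly ns.S25, open in print.

References: P. G. Lemarié-Rieusset, *The Navier–Stokes Problem in the 21st Century* (2016),
Thm. 10.4 (p. 285); G. Seregin, V. Šverák, Comm. PDE 34 (2009) 171–201, Thm. 1.1–1.2;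
G. Koch, N. Nadirashvili, G. Seregin, V. Šverák, Acta Math. 203 (2009) 83–105, Thm. 5.3, 6.1–6.2;
T. Kato, Math. Z. 187 (1984), Thm. 4.
-/

noncomputable section

set_option linter.dupNamespace false -- nested layout Summit.<S>.<Sub>, Sub = S (D-0017)

open Set
open scoped ENNReal NNReal ContDiff
open Literature.Analysis.FluidPDE Literature.Analysis.FluidPDE.FourierNS
open Summit.NavierStokesRegularity.NavierStokesRegularity.Theorems.CertifiedBlowupAxisymBlowup

namespace Summit.NavierStokesRegularity.NavierStokesRegularity.Theorems.EnvelopeBound.Axisymmetric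

/-! ### Per datum: global regularity of the datum gives the crux's conclusion -/

/-- **A Clay datum with a global classical bounded-energy solution satisfies the conclusion of the
crux at every horizon.** Its Kato maximal time is `∞`
(`katoMaximalTime_eq_top_of_global_classical`), and below `T_max` the envelope bound holds
(`Kato.envelope_of_lt_katoMaximalTime`). [cite: Kato1984MathZ, Thm. 4] -/
theorem envelope_of_global_classical {ν : ℝ} (hν : 0 < ν)
    {u₀ : EuclideanSpace ℝ (Fin 3) → EuclideanSpace ℝ (Fin 3)} (hu : ContDiff ℝ (⊤ : ℕ∞) u₀)
    (hd : HasRapidSpatialDecay u₀) (hdiv : NSWave0.IsDivFree u₀)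
    {U : ℝ → EuclideanSpace ℝ (Fin 3) → EuclideanSpace ℝ (Fin 3)}
    {P : ℝ → EuclideanSpace ℝ (Fin 3) → ℝ} (hU : IsClassicalNSSolutionOn (Ici 0) ν 0 U P)
    (hU0 : U 0 = u₀) (hE : HasBoundedEnergy U) {T₀ : ℝ} (hT₀ : 0 < T₀) :
    ∃ C : ℝ, ∀ T : ℝ, T ≤ T₀ → ∀ V : ℝ → EuclideanSpace ℝ (Fin 3) → Fin 3 → ℂ,
      IsFourierMild (4 * Real.pi ^ 2 * ν) 4 0 T V → V 0 = fourierData hu hd →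
      ∀ t ∈ Set.Icc 0 T, ∀ ξ : EuclideanSpace ℝ (Fin 3), ‖ξ‖ ^ 2 * ‖V t ξ‖ ≤ C :=
  Kato.envelope_of_lt_katoMaximalTime hν hu hd hdiv hT₀
    (by
      rw [CompactAmplification.katoMaximalTime_eq_top_of_global_classical hν hd hU hU0 hE]
      exact ENNReal.ofReal_lt_top)

/-- **The same in the summit's vocabulary**: if the datum has a solution in Fefferman's sense
(`IsNavierStokesSolution`, smooth on the closed half space, bounded energy — the conclusion of
`NavierStokesRegularity` and of crux (B) at that datum), the conclusion of the crux holds at every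
horizon (bridge `isNavierStokesSolution_and_smooth_iff`). [cite: Kato1984MathZ, Thm. 4] -/
theorem envelope_of_clay {ν : ℝ} (hν : 0 < ν)
    {u₀ : EuclideanSpace ℝ (Fin 3) → EuclideanSpace ℝ (Fin 3)} (hu : ContDiff ℝ (⊤ : ℕ∞) u₀)
    (hd : HasRapidSpatialDecay u₀) (hdiv : NSWave0.IsDivFree u₀)
    (h : ∃ (u : ℝ → EuclideanSpace ℝ (Fin 3) → EuclideanSpace ℝ (Fin 3))
      (p : ℝ → EuclideanSpace ℝ (Fin 3) → ℝ),
      IsSmoothOnHalfSpace u ∧ IsSmoothOnHalfSpace p ∧ IsNavierStokesSolution ν 0 u₀ u p ∧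
        HasBoundedEnergy u)
    {T₀ : ℝ} (hT₀ : 0 < T₀) :
    ∃ C : ℝ, ∀ T : ℝ, T ≤ T₀ → ∀ V : ℝ → EuclideanSpace ℝ (Fin 3) → Fin 3 → ℂ,
      IsFourierMild (4 * Real.pi ^ 2 * ν) 4 0 T V → V 0 = fourierData hu hd →
      ∀ t ∈ Set.Icc 0 T, ∀ ξ : EuclideanSpace ℝ (Fin 3), ‖ξ‖ ^ 2 * ‖V t ξ‖ ≤ C := by
  obtain ⟨u, p, hus, hps, hns, hE⟩ := h
  obtain ⟨hcl, h0⟩ := (isNavierStokesSolution_and_smooth_iff).1 ⟨hns, hus, hps⟩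
  exact envelope_of_global_classical hν hu hd hdiv hcl h0 hE hT₀

/-! ### Unconditional: axisymmetric data without swirl -/

/-- **The crux holds on axisymmetric swirl-free Clay data (unconditionally).** For `ν > 0` and a
smooth, rapidly decaying, divergence-free datum `u₀` which is axisymmetric without swirl, one
constant bounds the critical envelope `‖ξ‖² ‖V(t,ξ)‖` along every Fourier-mild solution from
`𝓕u₀` on `[0, T]`, `T ≤ T₀`, for every horizon `T₀`: ns.S24 (Ladyzhenskaya 1968, Ukhovskii–Yudovich
1968; `axisymmetric_no_swirl_global_regularity_holds`) makes the Kato maximal time infinite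
(`katoMaximalTime_eq_top_of_hasNoSwirl`), and the envelope is bounded below `T_max`.
[cite: LemarieRieusset2016, Thm. 10.4 (p. 285)] -/
theorem envelope_of_hasNoSwirl {ν : ℝ} (hν : 0 < ν)
    {u₀ : EuclideanSpace ℝ (Fin 3) → EuclideanSpace ℝ (Fin 3)} (hu : ContDiff ℝ (⊤ : ℕ∞) u₀)
    (hd : HasRapidSpatialDecay u₀) (hdiv : NSWave0.IsDivFree u₀) (hax : IsAxisymmetric u₀)
    (hsw : HasNoSwirl u₀) {T₀ : ℝ} (hT₀ : 0 < T₀) :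
    ∃ C : ℝ, ∀ T : ℝ, T ≤ T₀ → ∀ V : ℝ → EuclideanSpace ℝ (Fin 3) → Fin 3 → ℂ,
      IsFourierMild (4 * Real.pi ^ 2 * ν) 4 0 T V → V 0 = fourierData hu hd →
      ∀ t ∈ Set.Icc 0 T, ∀ ξ : EuclideanSpace ℝ (Fin 3), ‖ξ‖ ^ 2 * ‖V t ξ‖ ≤ C :=
  Kato.envelope_of_lt_katoMaximalTime hν hu hd hdiv hT₀
    (by
      rw [CompactAmplification.katoMaximalTime_eq_top_of_hasNoSwirl hν hu (fun x => hdiv x) hd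
        hax hsw]
      exact ENNReal.ofReal_lt_top)

/-- **`EnvelopeBound` restricted to axisymmetric swirl-free data is a theorem** (the statement of
the crux with the two symmetry hypotheses added, closed by `envelope_of_hasNoSwirl`).
[cite: LemarieRieusset2016, Thm. 10.4 (p. 285)] -/
theorem envelopeBound_noSwirl :
    ∀ ν : ℝ, 0 < ν → ∀ (u₀ : EuclideanSpace ℝ (Fin 3) → EuclideanSpace ℝ (Fin 3))
      (hu : ContDiff ℝ (⊤ : ℕ∞) u₀) (hd : Literature.Analysis.FluidPDE.HasRapidSpatialDecay u₀),
      Literature.Analysis.FluidPDE.NSWave0.IsDivFree u₀ →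
      Literature.Analysis.FluidPDE.IsAxisymmetric u₀ → Literature.Analysis.FluidPDE.HasNoSwirl u₀ →
      ∀ T₀ : ℝ, 0 < T₀ → ∃ C : ℝ, ∀ T : ℝ, T ≤ T₀ →
        ∀ V : ℝ → EuclideanSpace ℝ (Fin 3) → Fin 3 → ℂ,
          Literature.Analysis.FluidPDE.FourierNS.IsFourierMild (4 * Real.pi ^ 2 * ν) 4 0 T V →
          V 0 = Literature.Analysis.FluidPDE.FourierNS.fourierData hu hd →
          ∀ t ∈ Set.Icc 0 T, ∀ ξ : EuclideanSpace ℝ (Fin 3), ‖ξ‖ ^ 2 * ‖V t ξ‖ ≤ C :=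
  fun _ hν _ hu hd hdiv hax hsw _ hT₀ => envelope_of_hasNoSwirl hν hu hd hdiv hax hsw hT₀

/-! ### The axisymmetric sector of the crux is exactly ns.S25 -/

/-- **(A) on axisymmetric Clay data ⟺ global regularity of axisymmetric Clay data (ns.S25).**
`→`: for an axisymmetric datum the envelope bound at every horizon gives a global smooth
bounded-energy solution by the unconditional axisymmetric case of crux (B)
(`BoundedEnvelope.boundedEnvelopeContinuation_axisymmetric`: a bounded `PM²` envelope puts the flow
in the critical Morrey class where blow-up is Type I, excluded for axisymmetric flows by
Seregin–Šverák 2009 / Koch–Nadirashvili–Seregin–Šverák 2009), i.e. the conclusion of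
`AxisymmetricSwirlRegularity` (bridge `isNavierStokesSolution_and_smooth_iff`). `←`:
`envelope_of_global_classical`. So on the axisymmetric class the crux carries no content beyond
the axisymmetric regularity problem itself, and none less. [cite: SereginSverak2009, Thm. 1.1–1.2] -/
theorem envelopeBound_axisymmetric_iff_axisymmetricSwirlRegularity :
    (∀ ν : ℝ, 0 < ν → ∀ (u₀ : EuclideanSpace ℝ (Fin 3) → EuclideanSpace ℝ (Fin 3))
      (hu : ContDiff ℝ (⊤ : ℕ∞) u₀) (hd : Literature.Analysis.FluidPDE.HasRapidSpatialDecay u₀),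
      Literature.Analysis.FluidPDE.NSWave0.IsDivFree u₀ →
      Literature.Analysis.FluidPDE.IsAxisymmetric u₀ →
      ∀ T₀ : ℝ, 0 < T₀ → ∃ C : ℝ, ∀ T : ℝ, T ≤ T₀ →
        ∀ V : ℝ → EuclideanSpace ℝ (Fin 3) → Fin 3 → ℂ,
          Literature.Analysis.FluidPDE.FourierNS.IsFourierMild (4 * Real.pi ^ 2 * ν) 4 0 T V →
          V 0 = Literature.Analysis.FluidPDE.FourierNS.fourierData hu hd →
          ∀ t ∈ Set.Icc 0 T, ∀ ξ : EuclideanSpace ℝ (Fin 3), ‖ξ‖ ^ 2 * ‖V t ξ‖ ≤ C) ↔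
      Literature.Analysis.FluidPDE.AxisymmetricSwirlRegularity := by
  constructor
  · intro hA ν hν u₀ hsm hdiv hdec hax
    have hdivW : NSWave0.IsDivFree u₀ := fun x => hdiv x
    obtain ⟨u, p, hus, hps, hns, hE⟩ :=
      BoundedEnvelope.boundedEnvelopeContinuation_axisymmetric ν hν u₀ hsm hdec hdivW hax
        (hA ν hν u₀ hsm hdec hdivW hax)
    obtain ⟨hcl, h0⟩ := (isNavierStokesSolution_and_smooth_iff).1 ⟨hns, hus, hps⟩
    exact ⟨u, p, hcl, h0, hE⟩
  · intro hAX ν hν u₀ hu hd hdiv hax T₀ hT₀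
    obtain ⟨U, P, hU, hU0, hE⟩ := hAX ν hν u₀ hu (fun x => hdiv x) hd hax
    exact envelope_of_global_classical hν hu hd hdiv hU hU0 hE hT₀

/-- **(A) ⇒ ns.S25**: the crux `EnvelopeBound` implies global regularity of every smooth, rapidly
decaying, divergence-free axisymmetric datum (with or without swirl). [cite: SereginSverak2009, Thm. 1.1–1.2] -/
theorem axisymmetricSwirlRegularity_of_envelopeBound
    (hA : Summit.NavierStokesRegularity.NavierStokesRegularity.Theses.FrozenSignCascade.EnvelopeBound) :
    Literature.Analysis.FluidPDE.AxisymmetricSwirlRegularity :=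
  envelopeBound_axisymmetric_iff_axisymmetricSwirlRegularity.1
    fun ν hν u₀ hu hd hdiv _ => hA ν hν u₀ hu hd hdiv

/-- **(A) refutes the crux of route CertifiedBlowup on the axisymmetric class**:
`EnvelopeBound → ¬ CertifiedBlowupAxisymBlowup` (stmt-NavierStokesRegularity-0727 is the negation
of ns.S25, `certifiedBlowupAxisymBlowup_iff_not_axisymmetricSwirlRegularity`). [folklore] -/
theorem not_certifiedBlowupAxisymBlowup_of_envelopeBound
    (hA : Summit.NavierStokesRegularity.NavierStokesRegularity.Theses.FrozenSignCascade.EnvelopeBound) :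
    ¬ Summit.NavierStokesRegularity.NavierStokesRegularity.Theses.CertifiedBlowup.CertifiedBlowupAxisymBlowup :=
  fun hC => (CompactAmplification.certifiedBlowupAxisymBlowup_iff_not_axisymmetricSwirlRegularity.1 hC)
    (axisymmetricSwirlRegularity_of_envelopeBound hA)

/-- **A certified axisymmetric blow-up refutes (A)** (contrapositive): a witness of
stmt-NavierStokesRegularity-0727 — a maximal Leray–Hopf classical solution of finite lifespan from
a rapidly decaying axisymmetric datum — makes `EnvelopeBound` false (and with it the summit,
`SummitEquivalence.envelopeBound_of_navierStokesRegularity`). [folklore] -/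
theorem not_envelopeBound_of_certifiedBlowupAxisymBlowup
    (hC : Summit.NavierStokesRegularity.NavierStokesRegularity.Theses.CertifiedBlowup.CertifiedBlowupAxisymBlowup) :
    ¬ Summit.NavierStokesRegularity.NavierStokesRegularity.Theses.FrozenSignCascade.EnvelopeBound :=
  fun hA => not_certifiedBlowupAxisymBlowup_of_envelopeBound hA hC

/-- **Kato form on the axisymmetric class.** For an axisymmetric Clay datum the following are
equivalent: (i) the conclusion of the crux at every horizon; (ii) `katoMaximalTime ν u₀ = ∞`.
((i) ⇒ (ii): the global classical solution of
`envelopeBound_axisymmetric_iff_axisymmetricSwirlRegularity`'s `→` at this datum and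
`katoMaximalTime_eq_top_of_global_classical`; (ii) ⇒ (i): `Kato.envelope_of_lt_katoMaximalTime`.)
So an envelope overshoot of an axisymmetric datum happens iff its Kato lifespan is finite, i.e.
iff the datum carries swirl and blows up (`not_hasNoSwirl_of_katoMaximalTime_lt_top`).
[cite: SereginSverak2009, Thm. 1.1–1.2] -/
theorem envelope_iff_katoMaximalTime_eq_top_of_isAxisymmetric {ν : ℝ} (hν : 0 < ν)
    {u₀ : EuclideanSpace ℝ (Fin 3) → EuclideanSpace ℝ (Fin 3)} (hu : ContDiff ℝ (⊤ : ℕ∞) u₀)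
    (hd : HasRapidSpatialDecay u₀) (hdiv : NSWave0.IsDivFree u₀) (hax : IsAxisymmetric u₀) :
    (∀ T₀ : ℝ, 0 < T₀ → ∃ C : ℝ, ∀ T : ℝ, T ≤ T₀ → ∀ V : ℝ → EuclideanSpace ℝ (Fin 3) → Fin 3 → ℂ,
      IsFourierMild (4 * Real.pi ^ 2 * ν) 4 0 T V → V 0 = fourierData hu hd →
      ∀ t ∈ Set.Icc 0 T, ∀ ξ : EuclideanSpace ℝ (Fin 3), ‖ξ‖ ^ 2 * ‖V t ξ‖ ≤ C) ↔
      katoMaximalTime ν u₀ = ⊤ := by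
  constructor
  · intro h
    obtain ⟨u, p, hus, hps, hns, hE⟩ :=
      BoundedEnvelope.boundedEnvelopeContinuation_axisymmetric ν hν u₀ hu hd hdiv hax h
    obtain ⟨hcl, h0⟩ := (isNavierStokesSolution_and_smooth_iff).1 ⟨hns, hus, hps⟩
    exact CompactAmplification.katoMaximalTime_eq_top_of_global_classical hν hd hcl h0 hE
  · intro htop T₀ hT₀
    exact Kato.envelope_of_lt_katoMaximalTime hν hu hd hdiv hT₀
      (by rw [htop]; exact ENNReal.ofReal_lt_top)

end Summit.NavierStokesRegularity.NavierStokesRegularity.Theorems.EnvelopeBound.Axisymmetric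

end
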